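import Summits.ResolutionOfSingularities.ResolutionOfSingularities.Theses.ShadowGame
import Literature.AlgebraicGeometry.Resolution.ResolutionLU
import Literature.AlgebraicGeometry.Resolution.AffineModelObstructions
import Mathlib.RingTheory.Jacobson.Ring

/-!
# Negative lemmas for crux `TorsorToLurelPerfect` (stmt-ResolutionOfSingularities-16162):
# load-bearing binders of the CONCLUSION `C p`

Crux `∀ p prime, H p → C p` (`H p` = torsor LU over perfect ground fields, `C p` = relative LU
over perfect ground fields; cdisprove cycle 1, §2 of `Cruxes/TorsorToLurelPerfect/Disproof.lean`).
Every statement below is a binder-mutation of `C p` written out in full (no new named `Prop`s),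
and is either REFUTED (the binder is load-bearing; the correspondingly mutated crux is then the
negation of its own hypothesis — a trap, not a theorem) or PROVED OUTRIGHT (the binder carries
the whole content).

* `not_lurelPerfect_without_kfg` — `K/k` finitely generated is load-bearing (every prime;
  `𝔽_p^alg / 𝔽_p` has no affine model, tree `not_exists_fg_isFractionRing_algebraicClosure`).
* `not_lurelPerfect_without_rfg` — `R.FG` is load-bearing (every prime; `R = K = 𝔽_p(X)` at the
  trivial valuation, Zariski's lemma).
* `not_lurelPerfect_without_rle` — `R ⊆ O` is load-bearing (every prime; `𝔽_p[X]` at the place at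
  infinity of `𝔽_p(X)`).
* `lurelPerfect_without_reg` — with regularity at the centre deleted, `C p` is a TRIVIALITY
  (`A = R ⊔` affine model): regularity is the entire content of the conclusion.
* (`k ⊆ O` is redundant given `R ⊆ O`, and `IsFractionRing A K` is redundant given
  `exists_affineModel`; both one-liners, recorded in the Disproof work file only.)
-/

set_option linter.dupNamespace false

open scoped Polynomial
open IsLocalRing
open Literature.AlgebraicGeometry.Resolution

namespace Summit.ResolutionOfSingularities.ResolutionOfSingularities.Theorems.TorsorToLurelPerfect.Negative

open Summit.ResolutionOfSingularities.ResolutionOfSingularities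

noncomputable section

/-! ### Conclusion binders -/

/-- **`K/k` finitely generated is LOAD-BEARING in `C p`**: relative LU over perfect ground fields
demanded for ALL extensions `K/k` is false in every prime characteristic (`k = 𝔽_p`,
`K = 𝔽_p^alg`, `O = K`, `R = k`). [folklore] -/
theorem not_lurelPerfect_without_kfg {p : ℕ} (hp : p.Prime) :
    ¬ ∀ (k K : Type) [Field k] [CharP k p] [PerfectField k] [Field K] [Algebra k K],
      ∀ O : ValuationSubring K, (∀ c : k, algebraMap k K c ∈ O) →
      ∀ R : Subalgebra k K, R.FG → R.toSubring ≤ O.toSubring →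
      ∃ (A : Subalgebra k K) (h : A.toSubring ≤ O.toSubring), R ≤ A ∧ A.FG ∧ IsFractionRing A K ∧
        IsRegularLocalRing (Localization.AtPrime
          (Ideal.comap (Subring.inclusion h) (maximalIdeal O))) := by
  intro h
  haveI : Fact p.Prime := ⟨hp⟩
  obtain ⟨A, -, -, hfg, hfr, -⟩ := h (ZMod p) (AlgebraicClosure (ZMod p)) ⊤
    (fun c => ValuationSubring.mem_top _) ⊥ Subalgebra.fg_bot (fun _ _ => ValuationSubring.mem_top _)
  exact not_exists_fg_isFractionRing_algebraicClosure p ⟨A, hfg, hfr⟩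

/-- **`R.FG` is LOAD-BEARING in `C p`**: demanded for ALL `k`-subalgebras `R ⊆ O` it is false in
every prime characteristic — at the trivial valuation `O = K` of `K = 𝔽_p(X)` take `R = K`; a
finitely generated `A ⊇ K` makes `K` a finitely generated `𝔽_p`-algebra, hence finite over `𝔽_p`
(Zariski's lemma, `finite_of_finite_type_of_isJacobsonRing`), contradicting the transcendence of
`X`. [folklore] -/
theorem not_lurelPerfect_without_rfg {p : ℕ} (hp : p.Prime) :
    ¬ ∀ (k K : Type) [Field k] [CharP k p] [PerfectField k] [Field K] [Algebra k K],
      (⊤ : IntermediateField k K).FG → ∀ O : ValuationSubring K, (∀ c : k, algebraMap k K c ∈ O) →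
      ∀ R : Subalgebra k K, R.toSubring ≤ O.toSubring →
      ∃ (A : Subalgebra k K) (h : A.toSubring ≤ O.toSubring), R ≤ A ∧ A.FG ∧ IsFractionRing A K ∧
        IsRegularLocalRing (Localization.AtPrime
          (Ideal.comap (Subring.inclusion h) (maximalIdeal O))) := by
  intro h
  haveI : Fact p.Prime := ⟨hp⟩
  obtain ⟨A, -, hle, hAfg, -, -⟩ := h (ZMod p) (FractionRing (Polynomial (ZMod p)))
    (IntermediateField.fg_top_iff.mpr
      (Algebra.EssFiniteType.comp (ZMod p) (Polynomial (ZMod p)) _))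
    ⊤ (fun _ => ValuationSubring.mem_top _) ⊤ (fun _ _ => ValuationSubring.mem_top _)
  have htop : (⊤ : Subalgebra (ZMod p) (FractionRing (Polynomial (ZMod p)))).FG := by
    rwa [← eq_top_iff.mpr hle]
  haveI : Algebra.FiniteType (ZMod p) (FractionRing (Polynomial (ZMod p))) := ⟨htop⟩
  haveI : Module.Finite (ZMod p) (FractionRing (Polynomial (ZMod p))) :=
    finite_of_finite_type_of_isJacobsonRing (ZMod p) _
  have hT : Transcendental (ZMod p)
      (algebraMap (Polynomial (ZMod p)) (FractionRing (Polynomial (ZMod p))) Polynomial.X) :=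
    (transcendental_algebraMap_iff (IsFractionRing.injective (Polynomial (ZMod p)) _)).mpr
      (Polynomial.transcendental_X (ZMod p))
  exact hT (Algebra.IsAlgebraic.isAlgebraic _)

/-- **`R ⊆ O` is LOAD-BEARING in `C p`** (trivially, every prime): at the place at infinity of
`K = 𝔽_p(X)` the finitely generated `R = 𝔽_p[X]` sits below no `A ⊆ O` (`|X|_∞ > 1`). [folklore] -/
theorem not_lurelPerfect_without_rle {p : ℕ} (hp : p.Prime) :
    ¬ ∀ (k K : Type) [Field k] [CharP k p] [PerfectField k] [Field K] [Algebra k K],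
      (⊤ : IntermediateField k K).FG → ∀ O : ValuationSubring K,
      (∀ c : k, algebraMap k K c ∈ O) → ∀ R : Subalgebra k K, R.FG →
      ∃ (A : Subalgebra k K) (h : A.toSubring ≤ O.toSubring), R ≤ A ∧ A.FG ∧ IsFractionRing A K ∧
        IsRegularLocalRing (Localization.AtPrime
          (Ideal.comap (Subring.inclusion h) (maximalIdeal O))) := by
  intro H
  classical
  haveI : Fact p.Prime := ⟨hp⟩
  set K := RatFunc (ZMod p)
  set O : ValuationSubring K := (RatFunc.inftyValuation (ZMod p)).valuationSubring with hOdef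
  have hO : ∀ c : ZMod p, algebraMap (ZMod p) K c ∈ O := by
    intro c
    rw [hOdef, Valuation.mem_valuationSubring_iff]
    by_cases hc : c = 0
    · simp [hc]
    · rw [RatFunc.algebraMap_eq_C, RatFunc.inftyValuation.C _ hc]
  have hKfg : (⊤ : IntermediateField (ZMod p) K).FG := ⟨{RatFunc.X}, by simp [K, RatFunc.adjoin_X]⟩
  obtain ⟨A, hA, hle, -, -, -⟩ := H (ZMod p) K hKfg O hO (Algebra.adjoin (ZMod p) {(RatFunc.X : K)})
    (Subalgebra.fg_def.mpr ⟨{(RatFunc.X : K)}, Set.finite_singleton _, rfl⟩)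
  have hX : (RatFunc.X : K) ∈ O :=
    hA (A.mem_toSubring.mpr (hle (Algebra.subset_adjoin (Set.mem_singleton _))))
  rw [hOdef, Valuation.mem_valuationSubring_iff, RatFunc.inftyValuation.X, ← WithZero.exp_zero,
    WithZero.exp_le_exp] at hX
  exact absurd hX (by decide)


/-- **Regularity at the centre is the ENTIRE CONTENT of `C p`**: with that conjunct deleted the
conclusion holds outright (`A = R ⊔ A₀`, `A₀` an affine model of `K` inside `O`, tree
`exists_affineModel`), in every characteristic and dimension. [folklore] -/
theorem lurelPerfect_without_reg (p : ℕ) :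
    ∀ (k K : Type) [Field k] [CharP k p] [PerfectField k] [Field K] [Algebra k K],
      (⊤ : IntermediateField k K).FG → ∀ O : ValuationSubring K, (∀ c : k, algebraMap k K c ∈ O) →
      ∀ R : Subalgebra k K, R.FG → R.toSubring ≤ O.toSubring →
      ∃ (A : Subalgebra k K) (_ : A.toSubring ≤ O.toSubring), R ≤ A ∧ A.FG ∧ IsFractionRing A K := by
  intro k K _ _ _ _ _ hKfg O hO R hRfg hRO
  obtain ⟨A₀, hA₀O, hA₀fg, hA₀fr⟩ := exists_affineModel k K hKfg O hO
  have hR'O : (R ⊔ A₀).toSubring ≤ O.toSubring := by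
    let Oalg : Subalgebra k K := { O.toSubring with algebraMap_mem' := hO }
    change R ⊔ A₀ ≤ Oalg
    exact sup_le (fun x hx => hRO hx) (fun x hx => hA₀O hx)
  exact ⟨R ⊔ A₀, hR'O, le_sup_left, hRfg.sup hA₀fg, isFractionRing_of_le le_sup_right hA₀fr⟩

end

end Summit.ResolutionOfSingularities.ResolutionOfSingularities.Theorems.TorsorToLurelPerfect.Negative
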